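import Literature.MathematicalPhysics.QuantumLattice.TorusSectorGibbsEntropyRowLimit
import Literature.MathematicalPhysics.QuantumLattice.FermionConditionalFreeEnergyCertificate
import HarnessLib

/-!
# The CONDITIONAL entropy row («cent») of the canonical sector Gibbs state of the `t–t'` Hubbard torus:
# window bound + dual certificate, finite volume and thermodynamic limit

Topic `MathematicalPhysics/QuantumLattice`; the conditional-entropy twin of `TorusSectorGibbsEntropyRow(Limit).lean`.
For the canonical Gibbs density `ρ_{L,β} = sectorGibbsDensityTT'` (even, translation invariant,
`β(E_β − E₀) ≤ S(ρ_{L,β})`, `TorusSectorGibbsDensity.lean`), a WINDOW `Λ ⊆ [0,ℓ)²` with lexicographically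
largest site `a` (shield `Λ ∖ a`), the Markov bound of `TorusMarkovPressureBound.lean`
(`torus_vonNeumannEntropy_le_window`: `S(ρ) ≤ N_w·(S(ρ_Λ) − S(ρ_{Λ∖a})) + (L² − N_w)·log 4`, `N_w = (L+1−ℓ)²`,
valid for EVERY even translation-invariant density matrix, hence for the canonical one) and the dual
certificate of `FermionConditionalFreeEnergyCertificate.lean` (`fermion_condFreeEnergy_le_of_certificate`:
`S(σ) − S(σ_{Λ∖a}) − Re tr(σ H) ≤ c` whenever `e^c·e^{L_B} − tr_{Λ→Λ∖a} e^{−H + Γ L_B} ⪰ 0`) give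

* `sectorGibbs_energy_sub_groundEnergy_le_window` (finite volume):
  `β(E_β(L) − E₀(L)) ≤ N_w·(Σ_i p_{L,i} Re torusAvgExpectAt L Λ H ψ_{L,i} + c) + (L² − N_w)·log 4`;
* `IsTorusLimitOfMixture.meanEnergy_sub_re_expect_div_le_of_sectorGibbs_window` (thermodynamic limit, by
  the row passage of `TorusLimitOfMixturesLimsup.lean`): for every torus limit `ω` of the canonical sector
  Gibbs states at `β > 0` (`U ≥ 0`, `0 ≤ n < 2`):
  `e_Φ(ω) − Re ω_Λ(H)/β ≤ e(t,t',U,n) + c/β`.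

With `H = G − Γ G_W` (witness pair on the window and its shield) and the Golden–Thompson constant
`c ≥ log λ_max(tr_a e^{Γ G_W − G})` (the certificate with `L_B = 0`), or any dual variable `L_B`, this is the
«cent» row `ω(h₀) − (1/β)[ω(Ĝ) − ω(Ĝ_W) + c] ≤ e₀ ≤ f⁺` of the thermal certificates, for the tree's thermal
object. Everything is PROVED; no definition, no named fact.

References: Poulin–Hastings 2011 eqs. (3)–(8) [PoulinHastings2011]; Araki–Moriya 2003 Thm. 3.8/§10
[ArakiMoriya2003]; Lindblad 1975 Lemma 2 [Lindblad1975]; Israel 1979 Lemma II.3.1 [Israel1979].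
-/

noncomputable section

namespace Literature.MathematicalPhysics.QuantumLattice

open Matrix Finset HubbardWave0 Literature.Probability.LatticeModels ThermodynamicLimit
open Literature.InformationTheory.Entropy (vonNeumannEntropy)
open _root_.Filter
open scoped _root_.Topology ComplexOrder BigOperators

/-! ### §1 Finite volume -/

section Finite

variable (L : ℕ) [NeZero L]

/-- The shield of a pulled-back window is the pulled-back shield (`tr_{Λ→Λ∖a} ∘ tr_{torus→Λ} = tr_{torus→Λ∖a}`).
[folklore] -/
private theorem incl_erase_trans_toTorusEmb {Λ : Finset (Site 2)} (a : Site 2) {ℓ : ℕ}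
    (hΛ : Λ ⊆ halfOpenBox 2 ℓ) (hℓL : ℓ ≤ L) :
    (PolySite.incl (Λ.erase_subset a)).trans (PolySite.toTorusEmb L (injOn_proj_of_subset_halfOpenBox' hΛ hℓL)) =
      PolySite.toTorusEmb L (injOn_proj_of_subset_halfOpenBox' ((Λ.erase_subset a).trans hΛ) hℓL) :=
  DFunLike.ext _ _ fun _ => rfl

/-- **Finite-volume conditional-entropy row of the canonical sector Gibbs state.** For `0 ≤ n ≤ 2`, `β > 0`,
a window `Λ ⊆ [0,ℓ)²` (`ℓ ≤ L`) with lexicographically largest site `a`, Hermitian `H ∈ 𝔄_Λ` and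
`L_B ∈ 𝔄_{Λ∖a}`, a real `c`, and the certificate `e^c·e^{L_B} − tr_{Λ→Λ∖a} exp(−H + Γ L_B) ⪰ 0`:
`β·(E_β(L) − E₀(L)) ≤ N_w·(Σ_i p_{L,i} Re torusAvgExpectAt L Λ H ψ_{L,i} + c) + (L² − N_w)·log 4`, `N_w = (L+1−ℓ)²`
(`F ≤ E₀`; Markov window bound for the even TI density `ρ_{L,β}`; the certificate on the window marginal;
the window expectation of `H` is the mixture torus average by translation invariance).
[cite: PoulinHastings2011, eqs. (3)–(8)] [cite: ArakiMoriya2003, Theorem 3.8 and §10] -/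
theorem sectorGibbs_energy_sub_groundEnergy_le_window (t t' U : ℝ) {n : ℝ} (hn0 : 0 ≤ n) (hn2 : n ≤ 2)
    {β : ℝ} (hβ : 0 < β) {Λ : Finset (Site 2)} {a : Site 2} (ha : a ∈ Λ) (hmax : ∀ y ∈ Λ, toLex y ≤ toLex a)
    {ℓ : ℕ} (hΛ : Λ ⊆ halfOpenBox 2 ℓ) (hℓL : ℓ ≤ L)
    {H : FermionOp Λ} (hH : H.IsHermitian) {LB : FermionOp (Λ.erase a)} (hLB : LB.IsHermitian) {c : ℝ}
    (hcert : ((Real.exp c : ℂ) • cfc Real.exp LB -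
      fermionPartialTrace (PolySite.incl (Finset.erase_subset a Λ))
        (cfc Real.exp (-H + fermionEmbed (PolySite.incl (Finset.erase_subset a Λ)) LB))).PosSemidef) :
    β * (∑ i, sectorGibbsWeightTT' β t t' U n L i *
          (expect (hubbardTorusTT' L t t' U) (sectorGibbsVectorTT' t t' U n L i)).re -
        groundEnergy (hubbardTorusTT' L t t' U) (rectN n L)) ≤
      (((L + 1 - ℓ) ^ 2 : ℕ) : ℝ) *
          (∑ i, sectorGibbsWeightTT' β t t' U n L i *
              (torusAvgExpectAt L Λ H (sectorGibbsVectorTT' t t' U n L i)).re + c) +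
        (((L ^ 2 : ℕ) : ℝ) - (((L + 1 - ℓ) ^ 2 : ℕ) : ℝ)) * Real.log 4 := by
  set ρ := sectorGibbsDensityTT' L β t t' U n with hρ
  have hρpsd : ρ.PosSemidef := posSemidef_sectorGibbsDensityTT' L β t t' U n
  have hρtr : ρ.trace = 1 := trace_sectorGibbsDensityTT' L β t t' U hn0 hn2
  -- thermodynamics
  have h1 := mul_sub_groundEnergy_le_vonNeumannEntropy_sectorGibbsDensityTT' L t t' U hn0 hn2 hβ.le
  rw [re_trace_sectorGibbsDensityTT'_mul] at h1
  -- Markov window bound for the even TI density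
  have h2 := torus_vonNeumannEntropy_le_window L hρpsd hρtr (parityAut_sectorGibbsDensityTT' L β t t' U n)
    (relabel_translate_sectorGibbsDensityTT' L β t t' U n) ha hmax hΛ hℓL
  -- the certificate on the window marginal
  set hinj := injOn_proj_of_subset_halfOpenBox' hΛ hℓL with hinj_def
  set σ : FermionOp Λ := fermionPartialTrace (PolySite.toTorusEmb L hinj) ρ with hσ
  have hσpsd : σ.PosSemidef := posSemidef_fermionPartialTrace _ hρpsd
  have hσtr : σ.trace = 1 := by rw [hσ, trace_fermionPartialTrace, hρtr]
  have h3 := fermion_condFreeEnergy_le_of_certificate ha hmax hσpsd hσtr hH hLB hcert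
  -- the shield marginal of `σ` is the shield marginal of `ρ`
  have hshield : fermionPartialTrace (PolySite.incl (Finset.erase_subset a Λ)) σ =
      fermionPartialTrace (PolySite.toTorusEmb L
        (injOn_proj_of_subset_halfOpenBox' ((Λ.erase_subset a).trans hΛ) hℓL)) ρ := by
    rw [hσ, ← fermionPartialTrace_trans, incl_erase_trans_toTorusEmb L a hΛ hℓL]
  rw [hshield] at h3
  -- the window expectation of `H`
  have htrace : (σ * H).trace.re =
      ∑ i, sectorGibbsWeightTT' β t t' U n L i * (torusAvgExpectAt L Λ H (sectorGibbsVectorTT' t t' U n L i)).re := by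
    rw [Matrix.trace_mul_comm, hσ, trace_mul_fermionPartialTrace,
      re_trace_fermionEmbed_toTorusEmb_mul_sectorGibbsDensityTT']
  rw [htrace] at h3
  rw [← hρ] at h1
  have hN : (0 : ℝ) ≤ (((L + 1 - ℓ) ^ 2 : ℕ) : ℝ) := Nat.cast_nonneg _
  have h4 := mul_le_mul_of_nonneg_left (show vonNeumannEntropy σ -
      vonNeumannEntropy (fermionPartialTrace (PolySite.toTorusEmb L
        (injOn_proj_of_subset_halfOpenBox' ((Λ.erase_subset a).trans hΛ) hℓL)) ρ) ≤
      ∑ i, sectorGibbsWeightTT' β t t' U n L i * (torusAvgExpectAt L Λ H (sectorGibbsVectorTT' t t' U n L i)).re + c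
      by linarith) hN
  have h5 := add_le_add h4 (le_refl ((((L ^ 2 : ℕ) : ℝ) - (((L + 1 - ℓ) ^ 2 : ℕ) : ℝ)) * Real.log 4))
  exact h1.trans (h2.trans h5)

end Finite

/-! ### §2 The thermodynamic limit -/

section Limit

/-- From `β(E − E₀) ≤ N(A + c) + (L² − N)·l₄`, `N ≤ L²`, `|A| ≤ M` and the smallness of `δ = 1 − N/L²`:
`E/L² − A/β ≤ E₀/L² + c/β + ε`. [folklore] -/
private theorem row_algebra_window {β Lsq N E E0 A c M ε δ l4 : ℝ} (hβ : 0 < β) (hL : 0 < Lsq)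
    (hrow : β * (E - E0) ≤ N * (A + c) + (Lsq - N) * l4) (hN : N ≤ Lsq) (hA : |A| ≤ M)
    (hδ : δ = 1 - N / Lsq) (hε : δ * (l4 + M + |c|) / β ≤ ε) :
    E / Lsq - 1 / β * A ≤ E0 / Lsq + c / β + ε := by
  have hδ0 : 0 ≤ δ := by
    rw [hδ, sub_nonneg, div_le_one hL]
    exact hN
  have e1 : N - Lsq = -(Lsq * δ) := by rw [hδ]; field_simp; ring
  have hLδ : 0 ≤ Lsq * δ := mul_nonneg hL.le hδ0
  have hA' : -A ≤ M := (neg_le_abs A).trans hA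
  have hc : -c ≤ |c| := neg_le_abs c
  have hε' : δ * (l4 + M + |c|) ≤ β * ε := by
    rwa [div_le_iff₀ hβ, mul_comm ε β] at hε
  have key : (N - Lsq) * A + (N - Lsq) * c + (Lsq - N) * l4 ≤ β * Lsq * ε := by
    rw [show Lsq - N = Lsq * δ by linarith [e1], e1]
    have h1 : -(Lsq * δ) * A ≤ Lsq * δ * M := by
      rw [neg_mul, ← mul_neg]; exact mul_le_mul_of_nonneg_left hA' hLδ
    have h2 : -(Lsq * δ) * c ≤ Lsq * δ * |c| := by
      rw [neg_mul, ← mul_neg]; exact mul_le_mul_of_nonneg_left hc hLδ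
    have h3 : Lsq * (δ * (l4 + M + |c|)) ≤ Lsq * (β * ε) := mul_le_mul_of_nonneg_left hε' hL.le
    nlinarith
  have hβL : 0 < β * Lsq := mul_pos hβ hL
  rw [show E / Lsq - 1 / β * A = (β * E - Lsq * A) / (β * Lsq) by field_simp,
    show E0 / Lsq + c / β + ε = (β * E0 + Lsq * c + β * Lsq * ε) / (β * Lsq) by field_simp,
    div_le_div_iff_of_pos_right hβL]
  nlinarith

/-- `(L + 1 − ℓ)² / L² → 1`. [cite: FriedliVelenik2017, §6.9] -/
private theorem tendsto_sq_sub_div_sq (ℓ : ℕ) :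
    Tendsto (fun L : ℕ => ((L + 1 - ℓ : ℕ) : ℝ) ^ 2 / (L : ℝ) ^ 2) atTop (𝓝 1) := by
  have h0 : Tendsto (fun L : ℕ => 1 + (1 - (ℓ : ℝ)) / (L : ℝ)) atTop (𝓝 (1 + 0)) :=
    tendsto_const_nhds.add (tendsto_const_div_atTop_nhds_zero_nat _)
  rw [add_zero] at h0
  have h := h0.mul h0
  rw [mul_one] at h
  refine h.congr' ?_
  filter_upwards [eventually_ge_atTop (ℓ + 1)] with L hL
  have hL' : (L : ℝ) ≠ 0 := Nat.cast_ne_zero.2 (by omega)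
  rw [Nat.cast_sub (by omega)]
  field_simp
  push_cast
  ring

/-- **The CONDITIONAL ENTROPY ROW for thermal torus limits.** Let `ω` be a torus limit of the canonical
`(rectN n L, S^z = 0)` Gibbs states of `hubbardTorusTT' L t t' U` at `β > 0` (`IsTorusLimitOfMixture`, any
`Ls → ∞`; `U ≥ 0`, `0 ≤ n < 2`), `Λ ⊆ [0,ℓ)²` a window with lexicographically largest site `a`,
`H ∈ 𝔄_Λ`, `L_B ∈ 𝔄_{Λ∖a}` Hermitian and `c` real with the certificate
`e^c·e^{L_B} − tr_{Λ→Λ∖a} exp(−H + Γ L_B) ⪰ 0`. Then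
`e_{Φ(t,t',U)}(ω) − Re ω_Λ(H)/β ≤ e(t,t',U,n) + c/β` — the entropy density is at most the conditional
entropy `S(a | Λ∖a)(ω) ≤ Re ω(H) + c`, and `e − T s ≤ e₀`. With `H = G − Γ G_W` and `L_B = 0` (`c` the
Golden–Thompson constant `log λ_max tr_a e^{ΓG_W − G}`) this is the «cent» row of the thermal certificates.
[cite: PoulinHastings2011, eqs. (3)–(8)] [cite: ArakiMoriya2003, Theorem 3.8 and §10] -/
theorem IsTorusLimitOfMixture.meanEnergy_sub_re_expect_div_le_of_sectorGibbs_window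
    (t t' : ℝ) {U : ℝ} (hU : 0 ≤ U) {n : ℝ} (hn0 : 0 ≤ n) (hn2 : n < 2) {β : ℝ} (hβ : 0 < β)
    {ω : InfVolFermionState 2} {Ls : ℕ → ℕ}
    (h : ω.IsTorusLimitOfMixture (sectorGibbsCount n) (fun L => sectorGibbsWeightTT' β t t' U n L)
      (fun L => sectorGibbsVectorTT' t t' U n L) Ls)
    (hLs : Tendsto Ls atTop atTop) {Λ : Finset (Site 2)} {a : Site 2} (ha : a ∈ Λ)
    (hmax : ∀ y ∈ Λ, toLex y ≤ toLex a) {ℓ : ℕ} (hΛ : Λ ⊆ halfOpenBox 2 ℓ)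
    {H : FermionOp Λ} (hH : H.IsHermitian) {LB : FermionOp (Λ.erase a)} (hLB : LB.IsHermitian) {c : ℝ}
    (hcert : ((Real.exp c : ℂ) • cfc Real.exp LB -
      fermionPartialTrace (PolySite.incl (Finset.erase_subset a Λ))
        (cfc Real.exp (-H + fermionEmbed (PolySite.incl (Finset.erase_subset a Λ)) LB))).PosSemidef) :
    ω.meanEnergy (hubbardTTPrimeFermionInteraction t t' U) 1 - 1 / β * (ω.expect Λ H).re ≤
      energyDensityTT' t t' U n + c / β := by
  set M : ℝ := ∑ s, ∑ t, ‖H s t‖ with hMdef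
  set K : ℝ := Real.log 4 + M + |c| with hK
  have hδ : Tendsto (fun L : ℕ => (1 - ((L + 1 - ℓ : ℕ) : ℝ) ^ 2 / (L : ℝ) ^ 2) * K / β) atTop (𝓝 0) := by
    have h1 := (tendsto_const_nhds (x := (1 : ℝ))).sub (tendsto_sq_sub_div_sq ℓ)
    rw [sub_self] at h1
    have h2 := (h1.mul_const K).div_const β
    rwa [zero_mul, zero_div] at h2
  have key := h.mul_meanEnergy_add_mul_re_expect_le_of_eventually_sectorGibbs t t' hU hn0 hn2 β hLs
    Λ H (a := 1) (κ := -(1 / β)) (b := 1) (c := c / β) ?_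
  · simpa [sub_eq_add_neg] using key
  intro ε hε
  filter_upwards [hδ.eventually (gt_mem_nhds hε), eventually_ge_atTop (ℓ + 1)] with L hδL hL
  haveI : NeZero L := ⟨by omega⟩
  have hℓL : ℓ ≤ L := by omega
  have hℓ1 : 1 ≤ ℓ := by
    have h0 := (mem_halfOpenBox.1 (hΛ ha)) 0
    omega
  have hL0 : (0 : ℝ) < (L : ℝ) := Nat.cast_pos.2 (NeZero.pos L)
  have hLsq : (0 : ℝ) < (L : ℝ) ^ 2 := by positivity
  have hrow := sectorGibbs_energy_sub_groundEnergy_le_window L t t' U hn0 hn2.le hβ ha hmax hΛ hℓL hH hLB hcert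
  push_cast at hrow
  have havg : (∑ i, (sectorGibbsWeightTT' β t t' U n L i : ℂ) *
        torusAvgExpect L Λ H (sectorGibbsVectorTT' t t' U n L i)).re =
      ∑ i, sectorGibbsWeightTT' β t t' U n L i * (torusAvgExpectAt L Λ H (sectorGibbsVectorTT' t t' U n L i)).re := by
    rw [Complex.re_sum]
    refine Finset.sum_congr rfl fun i _ => ?_
    rw [Complex.re_ofReal_mul, torusAvgExpect_eq]
  have hA : |∑ i, sectorGibbsWeightTT' β t t' U n L i *
      (torusAvgExpectAt L Λ H (sectorGibbsVectorTT' t t' U n L i)).re| ≤ M := by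
    have h := abs_sum_mul_re_torusAvgExpect_le L Λ H
      (fun i => sectorGibbsWeightTT' β t t' U n L i) (fun i => sectorGibbsVectorTT' t t' U n L i)
      (fun i => sectorGibbsWeightTT'_nonneg β t t' U n L i) (sum_sectorGibbsWeightTT' β t t' U hn0 hn2.le L)
      (fun i => star_sectorGibbsVectorTT'_dotProduct_self t t' U n L i)
    simp_rw [torusAvgExpect_eq] at h
    exact h
  have henergy : ∑ i, sectorGibbsWeightTT' β t t' U n L i *
        ((expect (hubbardTorusTT' L t t' U) (sectorGibbsVectorTT' t t' U n L i)).re / (L : ℝ) ^ 2) =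
      (∑ i, sectorGibbsWeightTT' β t t' U n L i *
        (expect (hubbardTorusTT' L t t' U) (sectorGibbsVectorTT' t t' U n L i)).re) / (L : ℝ) ^ 2 := by
    rw [Finset.sum_div]
    refine Finset.sum_congr rfl fun i _ => ?_
    ring
  have hNle : ((L + 1 - ℓ : ℕ) : ℝ) ^ 2 ≤ (L : ℝ) ^ 2 := by
    have : ((L + 1 - ℓ : ℕ) : ℝ) ≤ (L : ℝ) := by exact_mod_cast (show L + 1 - ℓ ≤ L by omega)
    exact pow_le_pow_left₀ (Nat.cast_nonneg _) this 2
  have halg := row_algebra_window (ε := ε) hβ hLsq hrow hNle hA rfl hδL.le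
  rw [havg, henergy, one_mul, one_mul]
  linarith

end Limit

end Literature.MathematicalPhysics.QuantumLattice

end
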